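import Summits.ResolutionOfSingularities.ResolutionOfSingularities.Theses.FrobeniusLadder
import Summits.ResolutionOfSingularities.ResolutionOfSingularities.Theorems.FrobeniusLadderFInjectiveMacaulayficationStubCmGlue
import Summits.ResolutionOfSingularities.ResolutionOfSingularities.Theorems.FrobeniusLadderFRationalResolutionStubClauseOfRingEquiv
import Summits.ResolutionOfSingularities.ResolutionOfSingularities.Theorems.FInjectiveMacaulayfication.Negative.LoadBearing
import Literature.AlgebraicGeometry.Resolution.Macaulayfication
import Literature.AlgebraicGeometry.Resolution.ResolutionOfCurves
import Literature.AlgebraicGeometry.Resolution.ComponentGluing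
import Mathlib.AlgebraicGeometry.Noetherian
import HarnessLib

/-!
# Crux `FInjectiveMacaulayfication` — what the line `Sketch` reduces it to, certified

Support lemmas for crux stmt-ResolutionOfSingularities-15315
(`Summit.ResolutionOfSingularities.ResolutionOfSingularities.Theses.FrobeniusLadder.FInjectiveMacaulayfication`,
route `FrobeniusLadder`, rung 2: every reduced separated finite-type `X/k`, `char k = p`, has a proper
birational model whose stalks are Cohen–Macaulay F-injective domains), filed by the line lead (line
`Sketch`, skeleton `Cruxes/FInjectiveMacaulayfication/Lines/Sketch.lean`). Four certified facts about the
SIZE of what is open: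

* §1 `fiClause_of_ringEquiv`, `fiClause_coprod` — the full per-stalk clause of the crux (domain ∧ every
  system of parameters weakly regular ∧ every parameter ideal Frobenius closed, inline form) transports
  along ring isomorphisms and passes to binary disjoint unions of schemes.
* §2 `fInjectiveMacaulayfication_iff_integral` — the crux is EQUIVALENT to its integral form ("every
  INTEGRAL separated finite-type `X/k` has a proper birational INTEGRAL model with the clause at every
  stalk"), as the route header asserts modulo folklore: reduced ⇒ integral components with their reduced
  structure, models glued as a disjoint union (`exists_model_of_forall_closeds` of the `cmGlue` file);
  conversely the source of a birational morphism onto an integral scheme, having domain stalks, is integral.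
* §3 `stubFInjectivize_of_fInjectiveMacaulayfication`, `fInjectiveMacaulayfication_of_kawasaki_of_stubFInjectivize`
  — the line's open stub `stub_fInjectivize` ("F-injectivise a separated finite-type `k`-scheme whose stalks
  are Cohen–Macaulay domains by a proper birational CM-preserving modification") is CRUX-SIZED: the crux
  implies it outright (a scheme with domain stalks is reduced), and together with the in-print rung below
  (`Literature…KawasakiMacaulayfication`, Kawasaki 2000 Thm 1.1, a named fact) it implies the crux — this
  second implication is the line's skeleton with its two open stubs turned into hypotheses, sorry-free.
  So, modulo Kawasaki's theorem, `stub_fInjectivize ↔ crux`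
  (`fInjectiveMacaulayfication_iff_stubFInjectivize`).
* §4 `conclusion_of_dim_le_one` — the crux's conclusion holds UNCONDITIONALLY for every reduced `X` of
  finite type over `k` with `dim X ≤ 1` (the normalisation of a reduced curve is a finite resolution,
  `Literature…hasResolution_of_dim_le_one`; a resolution is an F-injective Macaulayfication,
  `Negative.conclusion_of_hasResolution`). With `Negative.conclusion_of_dim_le_three` (modulo
  `CossartPiltant2019`) this brackets the open content: dimension `2` unconditionally, dimension `4`
  modulo the named fact.

No definition is declared; every statement is written inline in the route file's vocabulary.
-/

-- single-problem summit: the doubled namespace component `ResolutionOfSingularities` is forced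
set_option linter.dupNamespace false

noncomputable section

open CategoryTheory CategoryTheory.Limits AlgebraicGeometry TopologicalSpace
open Literature.AlgebraicGeometry.Resolution
open Summit.ResolutionOfSingularities.ResolutionOfSingularities.Theses.FrobeniusLadder

namespace Summit.ResolutionOfSingularities.ResolutionOfSingularities.Theorems.FInjectiveMacaulayfication

/-! ## §1 The full stalk clause: transport along ring isomorphisms, disjoint unions -/

/-- The crux's per-stalk clause — "`A` is a domain, every system of parameters of `A` (`d = dim A`
elements generating an ideal with maximal radical) is a weakly regular sequence, and the ideal it
generates is Frobenius closed for the exponent base `p` (inline form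
`(∃ e, y^(p^e) ∈ span {z^(p^e) | z ∈ (s)}) → y ∈ (s)`)" — transports along a ring isomorphism
`e : A ≃+* B` (pull the tuple and the membership back along `e.symm`; no characteristic hypothesis is
needed, the clause is purely ring-theoretic). [folklore] -/
theorem fiClause_of_ringEquiv (p : ℕ) {A B : Type} [CommRing A] [CommRing B] (e : A ≃+* B)
    (h : IsDomain A ∧ ∀ d : ℕ, ringKrullDim A = d → ∀ s : Fin d → A,
      (Ideal.span (Set.range s)).radical.IsMaximal →
        RingTheory.Sequence.IsWeaklyRegular A (List.ofFn s) ∧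
        ∀ y : A, (∃ n : ℕ, y ^ p ^ n ∈ Ideal.span ((fun z : A => z ^ p ^ n) ''
          (Ideal.span (Set.range s) : Set A))) → y ∈ Ideal.span (Set.range s)) :
    IsDomain B ∧ ∀ d : ℕ, ringKrullDim B = d → ∀ s : Fin d → B,
      (Ideal.span (Set.range s)).radical.IsMaximal →
        RingTheory.Sequence.IsWeaklyRegular B (List.ofFn s) ∧
        ∀ y : B, (∃ n : ℕ, y ^ p ^ n ∈ Ideal.span ((fun z : B => z ^ p ^ n) ''
          (Ideal.span (Set.range s) : Set B))) → y ∈ Ideal.span (Set.range s) := by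
  obtain ⟨hdom, h⟩ := h
  have hcm := cmDomain_of_ringEquiv e ⟨hdom, fun d hd s hs => (h d hd s hs).1⟩
  refine ⟨hcm.1, fun d hd s hmax => ⟨hcm.2 d hd s hmax, ?_⟩⟩
  rintro y ⟨n, hn⟩
  have hdA : ringKrullDim A = d := by rw [ringKrullDim_eq_of_ringEquiv e, hd]
  have hI := FRationalResolution.ClauseInvariance.span_range_symm_comp e s
  have hmaxA : (Ideal.span (Set.range (e.symm ∘ s))).radical.IsMaximal := by
    rw [hI, ← Ideal.comap_radical]
    exact Ideal.comap_isMaximal_of_equiv e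
  have hmemA : e.symm y ^ p ^ n ∈ Ideal.span ((fun z : A => z ^ p ^ n) ''
      (Ideal.span (Set.range (e.symm ∘ s)) : Set A)) := by
    rw [hI]
    have h1 := FRationalResolution.ClauseInvariance.symm_mem_span_pow_image e p n
      (Ideal.span (Set.range s)) (y := y) (c := 1) (by rwa [one_mul])
    rwa [map_one, one_mul] at h1
  have hy := (h d hdA (e.symm ∘ s) hmaxA).2 (e.symm y) ⟨n, hmemA⟩
  rwa [hI, Ideal.mem_comap, RingEquiv.apply_symm_apply] at hy

/-- The full stalk clause on all stalks passes to binary disjoint unions of schemes (every point of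
`U ⨿ V` comes from `U` or `V` through the open immersions `coprod.inl`, `coprod.inr`, which induce
isomorphisms on stalks). [folklore] -/
theorem fiClause_coprod (p : ℕ) {U V : Scheme.{0}}
    (hU : ∀ x : U, IsDomain (U.presheaf.stalk x) ∧ ∀ d : ℕ, ringKrullDim (U.presheaf.stalk x) = d →
      ∀ s : Fin d → U.presheaf.stalk x, (Ideal.span (Set.range s)).radical.IsMaximal →
        RingTheory.Sequence.IsWeaklyRegular (U.presheaf.stalk x) (List.ofFn s) ∧
        ∀ y : U.presheaf.stalk x, (∃ n : ℕ, y ^ p ^ n ∈ Ideal.span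
          ((fun z : U.presheaf.stalk x => z ^ p ^ n) ''
            (Ideal.span (Set.range s) : Set (U.presheaf.stalk x)))) → y ∈ Ideal.span (Set.range s))
    (hV : ∀ x : V, IsDomain (V.presheaf.stalk x) ∧ ∀ d : ℕ, ringKrullDim (V.presheaf.stalk x) = d →
      ∀ s : Fin d → V.presheaf.stalk x, (Ideal.span (Set.range s)).radical.IsMaximal →
        RingTheory.Sequence.IsWeaklyRegular (V.presheaf.stalk x) (List.ofFn s) ∧
        ∀ y : V.presheaf.stalk x, (∃ n : ℕ, y ^ p ^ n ∈ Ideal.span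
          ((fun z : V.presheaf.stalk x => z ^ p ^ n) ''
            (Ideal.span (Set.range s) : Set (V.presheaf.stalk x)))) → y ∈ Ideal.span (Set.range s)) :
    ∀ x : ↥(U ⨿ V), IsDomain ((U ⨿ V).presheaf.stalk x) ∧
      ∀ d : ℕ, ringKrullDim ((U ⨿ V).presheaf.stalk x) = d →
      ∀ s : Fin d → (U ⨿ V).presheaf.stalk x, (Ideal.span (Set.range s)).radical.IsMaximal →
        RingTheory.Sequence.IsWeaklyRegular ((U ⨿ V).presheaf.stalk x) (List.ofFn s) ∧
        ∀ y : (U ⨿ V).presheaf.stalk x, (∃ n : ℕ, y ^ p ^ n ∈ Ideal.span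
          ((fun z : (U ⨿ V).presheaf.stalk x => z ^ p ^ n) ''
            (Ideal.span (Set.range s) : Set ((U ⨿ V).presheaf.stalk x)))) →
          y ∈ Ideal.span (Set.range s) := by
  intro z
  rcases coprod_point_cases z with ⟨x, rfl⟩ | ⟨y, rfl⟩
  · exact fiClause_of_ringEquiv p
      (asIso ((coprod.inl : U ⟶ U ⨿ V).stalkMap x)).commRingCatIsoToRingEquiv.symm (hU x)
  · exact fiClause_of_ringEquiv p
      (asIso ((coprod.inr : V ⟶ U ⨿ V).stalkMap y)).commRingCatIsoToRingEquiv.symm (hV y)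

/-! ## §2 The crux is equivalent to its integral form -/

/-- **Integral form ⇒ reduced form, one field and exponent at a time.** If every INTEGRAL separated
finite-type `X/k` has a proper birational model with integral source satisfying the clause at every
stalk, then every REDUCED separated finite-type `X/k` has a proper birational model satisfying the clause
at every stalk: apply the hypothesis to the finitely many irreducible components with their reduced
(= integral) closed-subscheme structure and take the disjoint union (`exists_model_of_forall_closeds`,
`fiClause_coprod`). [cite: CossartPiltant2019, proof of Prop. 4.6, Step 1 (arXiv v1: Prop. 4.4)] -/
theorem exists_fiModel_of_integralForm (p : ℕ) (k : Type) [Field k]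
    (hint : ∀ (X : Scheme.{0}) (f : X ⟶ Spec (.of k)), IsSeparated f → LocallyOfFiniteType f →
      QuasiCompact f → IsIntegral X →
      ∃ (X' : Scheme.{0}) (π : X' ⟶ X), IsProper π ∧ IsBirational π ∧ IsIntegral X' ∧ ∀ x : X',
        IsDomain (X'.presheaf.stalk x) ∧ ∀ d : ℕ, ringKrullDim (X'.presheaf.stalk x) = d →
          ∀ s : Fin d → X'.presheaf.stalk x, (Ideal.span (Set.range s)).radical.IsMaximal →
            RingTheory.Sequence.IsWeaklyRegular (X'.presheaf.stalk x) (List.ofFn s) ∧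
            ∀ y : X'.presheaf.stalk x, (∃ e : ℕ, y ^ p ^ e ∈ Ideal.span
              ((fun z : X'.presheaf.stalk x => z ^ p ^ e) ''
                (Ideal.span (Set.range s) : Set (X'.presheaf.stalk x)))) →
              y ∈ Ideal.span (Set.range s))
    (X : Scheme.{0}) (f : X ⟶ Spec (.of k)) [IsSeparated f] [LocallyOfFiniteType f] [QuasiCompact f]
    [IsReduced X] :
    ∃ (X' : Scheme.{0}) (π : X' ⟶ X), IsProper π ∧ IsBirational π ∧ ∀ x : X',
      IsDomain (X'.presheaf.stalk x) ∧ ∀ d : ℕ, ringKrullDim (X'.presheaf.stalk x) = d →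
        ∀ s : Fin d → X'.presheaf.stalk x, (Ideal.span (Set.range s)).radical.IsMaximal →
          RingTheory.Sequence.IsWeaklyRegular (X'.presheaf.stalk x) (List.ofFn s) ∧
          ∀ y : X'.presheaf.stalk x, (∃ e : ℕ, y ^ p ^ e ∈ Ideal.span
            ((fun z : X'.presheaf.stalk x => z ^ p ^ e) ''
              (Ideal.span (Set.range s) : Set (X'.presheaf.stalk x)))) →
            y ∈ Ideal.span (Set.range s) := by
  refine exists_model_of_forall_closeds
    (fun Y : Scheme.{0} => ∀ y : Y, IsDomain (Y.presheaf.stalk y) ∧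
      ∀ d : ℕ, ringKrullDim (Y.presheaf.stalk y) = d →
        ∀ s : Fin d → Y.presheaf.stalk y, (Ideal.span (Set.range s)).radical.IsMaximal →
          RingTheory.Sequence.IsWeaklyRegular (Y.presheaf.stalk y) (List.ofFn s) ∧
          ∀ w : Y.presheaf.stalk y, (∃ e : ℕ, w ^ p ^ e ∈ Ideal.span
            ((fun z : Y.presheaf.stalk y => z ^ p ^ e) ''
              (Ideal.span (Set.range s) : Set (Y.presheaf.stalk y)))) →
            w ∈ Ideal.span (Set.range s))
    (fun Y hY y => (hY.false y).elim) (fun U V hU hV => fiClause_coprod p hU hV) X f fun Z hZ => ?_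
  haveI := hZ
  obtain ⟨X', π, hprop, hbir, _, hfi⟩ :=
    hint _ ((Scheme.IdealSheafData.vanishingIdeal Z).subschemeι ≫ f) inferInstance inferInstance
      inferInstance hZ
  exact ⟨X', π, hprop, hbir, hfi⟩

/-- The source of a birational morphism onto an integral scheme is integral as soon as its stalks are
domains (it is reduced, `isReduced_of_isReduced_stalk`, and irreducible,
`ComponentGluing.IsBirational.irreducibleSpace`). [folklore] -/
theorem isIntegral_of_isBirational_of_isDomain_stalk {X' X : Scheme.{0}} [IsIntegral X]
    {π : X' ⟶ X} (hπ : IsBirational π) (h : ∀ x : X', IsDomain (X'.presheaf.stalk x)) :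
    IsIntegral X' := by
  haveI : ∀ x : X', IsDomain (X'.presheaf.stalk x) := h
  haveI : IsReduced X' := isReduced_of_isReduced_stalk X'
  haveI : IrreducibleSpace X' := ComponentGluing.IsBirational.irreducibleSpace hπ
  exact isIntegral_of_irreducibleSpace_of_isReduced X'

/-- **Crux `FInjectiveMacaulayfication` ↔ its integral form.** The rung-2 crux of route
`FrobeniusLadder` (every reduced separated finite-type `X/k`, `char k = p` prime, has a proper
birational model whose stalks are Cohen–Macaulay F-injective domains, inline clause) is EQUIVALENT to:
for every prime `p`, field `k` of characteristic `p` and INTEGRAL separated `k`-scheme `X` of finite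
type there is a proper birational `π : X' → X` with `X'` INTEGRAL and the clause at every stalk of `X'`.
Forward: an integral `X` is reduced, and the source of the crux's model is integral
(`isIntegral_of_isBirational_of_isDomain_stalk`). Backward: `exists_fiModel_of_integralForm` (integral
components, disjoint union). This is the "equivalent to the integral form modulo in-tree folklore"
sentence of the item text, proved. [folklore] -/
theorem fInjectiveMacaulayfication_iff_integral :
    Summit.ResolutionOfSingularities.ResolutionOfSingularities.Theses.FrobeniusLadder.FInjectiveMacaulayfication ↔
      ∀ p : ℕ, p.Prime → ∀ (k : Type) [Field k] [CharP k p] (X : Scheme.{0})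
        (f : X ⟶ Spec (.of k)), IsSeparated f → LocallyOfFiniteType f → QuasiCompact f →
        IsIntegral X →
        ∃ (X' : Scheme.{0}) (π : X' ⟶ X), IsProper π ∧ IsBirational π ∧ IsIntegral X' ∧ ∀ x : X',
          IsDomain (X'.presheaf.stalk x) ∧ ∀ d : ℕ, ringKrullDim (X'.presheaf.stalk x) = d →
            ∀ s : Fin d → X'.presheaf.stalk x, (Ideal.span (Set.range s)).radical.IsMaximal →
              RingTheory.Sequence.IsWeaklyRegular (X'.presheaf.stalk x) (List.ofFn s) ∧
              ∀ y : X'.presheaf.stalk x, (∃ e : ℕ, y ^ p ^ e ∈ Ideal.span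
                ((fun z : X'.presheaf.stalk x => z ^ p ^ e) ''
                  (Ideal.span (Set.range s) : Set (X'.presheaf.stalk x)))) →
                y ∈ Ideal.span (Set.range s) := by
  unfold FInjectiveMacaulayfication
  constructor
  · intro h p hp k _ _ X f hsep hft hqc hint
    obtain ⟨X', π, hprop, hbir, hfi⟩ := h p hp k X f hsep hft hqc inferInstance
    exact ⟨X', π, hprop, hbir, isIntegral_of_isBirational_of_isDomain_stalk hbir fun x => (hfi x).1,
      hfi⟩
  · intro hint p hp k _ _ X f hsep hft hqc hred
    haveI := hsep
    haveI := hft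
    haveI := hqc
    haveI := hred
    exact exists_fiModel_of_integralForm p k
      (fun Y g hs hl hq hY => hint p hp k Y g hs hl hq hY) X f

/-! ## §3 The open stub `stub_fInjectivize` of line `Sketch` is crux-sized -/

/-- **The crux implies the line's open stub `stub_fInjectivize` outright**: a separated finite-type
`k`-scheme whose stalks are (Cohen–Macaulay) domains is reduced, so the crux applies to it and yields
exactly the stub's conclusion. (The Cohen–Macaulay half of the stub's hypothesis is not even used: the
stub restricted to CM input is still the whole crux for reduced input with domain stalks, and by
`Negative.fInjectiveMacaulayfication_depthHalf_not_imp_frobeniusHalf` the CM hypothesis cannot be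
consumed pointwise.) The statement after `→` is the registered stub signature verbatim. [folklore] -/
theorem stubFInjectivize_of_fInjectiveMacaulayfication (h : FInjectiveMacaulayfication) :
    ∀ (p : ℕ), p.Prime → ∀ (k : Type) [Field k] [CharP k p] (X₁ : Scheme.{0})
      (f₁ : X₁ ⟶ Spec (.of k)), IsSeparated f₁ → LocallyOfFiniteType f₁ → QuasiCompact f₁ →
      (∀ x : X₁, IsDomain (X₁.presheaf.stalk x) ∧ ∀ d : ℕ, ringKrullDim (X₁.presheaf.stalk x) = d →
        ∀ s : Fin d → X₁.presheaf.stalk x, (Ideal.span (Set.range s)).radical.IsMaximal →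
          RingTheory.Sequence.IsWeaklyRegular (X₁.presheaf.stalk x) (List.ofFn s)) →
      ∃ (X' : Scheme.{0}) (π : X' ⟶ X₁), IsProper π ∧ IsBirational π ∧ ∀ x : X',
        IsDomain (X'.presheaf.stalk x) ∧ ∀ d : ℕ, ringKrullDim (X'.presheaf.stalk x) = d →
          ∀ s : Fin d → X'.presheaf.stalk x, (Ideal.span (Set.range s)).radical.IsMaximal →
            RingTheory.Sequence.IsWeaklyRegular (X'.presheaf.stalk x) (List.ofFn s) ∧
            ∀ y : X'.presheaf.stalk x, (∃ e : ℕ, y ^ p ^ e ∈ Ideal.span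
              ((fun z : X'.presheaf.stalk x => z ^ p ^ e) ''
                (Ideal.span (Set.range s) : Set (X'.presheaf.stalk x)))) →
              y ∈ Ideal.span (Set.range s) := by
  intro p hp k _ _ X₁ f₁ hsep hft hqc hCM
  haveI : ∀ x : X₁, IsDomain (X₁.presheaf.stalk x) := fun x => (hCM x).1
  haveI : IsReduced X₁ := isReduced_of_isReduced_stalk X₁
  exact h p hp k X₁ f₁ hsep hft hqc inferInstance

/-- **Kawasaki's Macaulayfication and the stub `stub_fInjectivize` together imply the crux** — the
skeleton of line `Sketch` (`Cruxes/FInjectiveMacaulayfication/Lines/Sketch.lean`,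
`FInjectiveMacaulayfication_proof`) with its two open stubs turned into hypotheses, sorry-free: glue the
integral Macaulayfications of the components into a model with Cohen–Macaulay domain stalks (landed stub
`stub_cmGlue`), F-injectivise it (the hypothesis `hF`), and compose — proper ∘ proper is proper,
birational ∘ birational is birational (`ComponentGluing.IsBirational.comp`). The first hypothesis is the
Literature named fact `KawasakiMacaulayfication` (Kawasaki 2000, Thm 1.1; Česnavičius 2021, Thm 1.6) at
universe `0`; the second is the registered stub signature verbatim.
[cite: Kawasaki2000, Thm 1.1] -/
theorem fInjectiveMacaulayfication_of_kawasaki_of_stubFInjectivize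
    (hK : KawasakiMacaulayfication.{0})
    (hF : ∀ (p : ℕ), p.Prime → ∀ (k : Type) [Field k] [CharP k p] (X₁ : Scheme.{0})
      (f₁ : X₁ ⟶ Spec (.of k)), IsSeparated f₁ → LocallyOfFiniteType f₁ → QuasiCompact f₁ →
      (∀ x : X₁, IsDomain (X₁.presheaf.stalk x) ∧ ∀ d : ℕ, ringKrullDim (X₁.presheaf.stalk x) = d →
        ∀ s : Fin d → X₁.presheaf.stalk x, (Ideal.span (Set.range s)).radical.IsMaximal →
          RingTheory.Sequence.IsWeaklyRegular (X₁.presheaf.stalk x) (List.ofFn s)) →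
      ∃ (X' : Scheme.{0}) (π : X' ⟶ X₁), IsProper π ∧ IsBirational π ∧ ∀ x : X',
        IsDomain (X'.presheaf.stalk x) ∧ ∀ d : ℕ, ringKrullDim (X'.presheaf.stalk x) = d →
          ∀ s : Fin d → X'.presheaf.stalk x, (Ideal.span (Set.range s)).radical.IsMaximal →
            RingTheory.Sequence.IsWeaklyRegular (X'.presheaf.stalk x) (List.ofFn s) ∧
            ∀ y : X'.presheaf.stalk x, (∃ e : ℕ, y ^ p ^ e ∈ Ideal.span
              ((fun z : X'.presheaf.stalk x => z ^ p ^ e) ''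
                (Ideal.span (Set.range s) : Set (X'.presheaf.stalk x)))) →
              y ∈ Ideal.span (Set.range s)) :
    FInjectiveMacaulayfication := by
  unfold FInjectiveMacaulayfication
  intro p hp k _ _ X f hsep hft hqc hred
  obtain ⟨X₁, π₁, hπ₁, hbir₁, hCM⟩ :=
    stub_cmGlue (fun k _ X f hs hl hq hX => hK k X f hs hl hq hX) k X f hsep hft hqc hred
  haveI := hπ₁
  haveI := hsep
  haveI := hft
  haveI := hqc
  have hsep₁ : IsSeparated (π₁ ≫ f) := inferInstance
  have hft₁ : LocallyOfFiniteType (π₁ ≫ f) := inferInstance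
  have hqc₁ : QuasiCompact (π₁ ≫ f) := inferInstance
  obtain ⟨X', π, hπ, hbir, hgood⟩ := hF p hp k X₁ (π₁ ≫ f) hsep₁ hft₁ hqc₁ hCM
  haveI := hπ
  refine ⟨X', π ≫ π₁, inferInstance, ?_, hgood⟩
  exact ComponentGluing.IsBirational.comp hbir hbir₁

/-- **Modulo Kawasaki's theorem the line's open stub IS the crux**: `stub_fInjectivize ↔ crux` under
the named fact `KawasakiMacaulayfication` — the certificate that line `Sketch` bottoms out at a
crux-sized stub (its landed engine lemmas `stub_propagation`, `stub_pigeonhole`, `stub_trapped_image`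
and the no-go witness do not enter the composition). [cite: Kawasaki2000, Thm 1.1] -/
theorem fInjectiveMacaulayfication_iff_stubFInjectivize (hK : KawasakiMacaulayfication.{0}) :
    FInjectiveMacaulayfication ↔
      ∀ (p : ℕ), p.Prime → ∀ (k : Type) [Field k] [CharP k p] (X₁ : Scheme.{0})
        (f₁ : X₁ ⟶ Spec (.of k)), IsSeparated f₁ → LocallyOfFiniteType f₁ → QuasiCompact f₁ →
        (∀ x : X₁, IsDomain (X₁.presheaf.stalk x) ∧ ∀ d : ℕ, ringKrullDim (X₁.presheaf.stalk x) = d →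
          ∀ s : Fin d → X₁.presheaf.stalk x, (Ideal.span (Set.range s)).radical.IsMaximal →
            RingTheory.Sequence.IsWeaklyRegular (X₁.presheaf.stalk x) (List.ofFn s)) →
        ∃ (X' : Scheme.{0}) (π : X' ⟶ X₁), IsProper π ∧ IsBirational π ∧ ∀ x : X',
          IsDomain (X'.presheaf.stalk x) ∧ ∀ d : ℕ, ringKrullDim (X'.presheaf.stalk x) = d →
            ∀ s : Fin d → X'.presheaf.stalk x, (Ideal.span (Set.range s)).radical.IsMaximal →
              RingTheory.Sequence.IsWeaklyRegular (X'.presheaf.stalk x) (List.ofFn s) ∧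
              ∀ y : X'.presheaf.stalk x, (∃ e : ℕ, y ^ p ^ e ∈ Ideal.span
                ((fun z : X'.presheaf.stalk x => z ^ p ^ e) ''
                  (Ideal.span (Set.range s) : Set (X'.presheaf.stalk x)))) →
                y ∈ Ideal.span (Set.range s) :=
  ⟨stubFInjectivize_of_fInjectiveMacaulayfication,
    fInjectiveMacaulayfication_of_kawasaki_of_stubFInjectivize hK⟩

/-! ## §4 Dimension `≤ 1`: the crux's conclusion holds unconditionally -/

/-- **Reduced curves (and points) have F-injective Macaulayfications, unconditionally**: for a reduced
`X` of finite type over a field `k` of prime characteristic `p` with `dim X ≤ 1`, the crux's conclusion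
holds — the normalisation is a finite resolution (`hasResolution_of_dim_le_one`, in tree, no named fact)
and a resolution is an F-injective Macaulayfication (`Negative.conclusion_of_hasResolution`: regular
local rings are domains whose systems of parameters are regular sequences generating Frobenius closed
ideals). Separatedness is not needed. So the open content of the crux starts in dimension `2`
unconditionally (and in dimension `4` modulo `CossartPiltant2019`, `Negative.conclusion_of_dim_le_three`).
[folklore] -/
theorem conclusion_of_dim_le_one {p : ℕ} (hp : p.Prime) (k : Type) [Field k] [CharP k p]
    (X : Scheme.{0}) (f : X ⟶ Spec (.of k)) [LocallyOfFiniteType f] [QuasiCompact f] [IsReduced X]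
    (hdim : topologicalKrullDim X ≤ 1) :
    ∃ (X' : Scheme.{0}) (π : X' ⟶ X), IsProper π ∧ IsBirational π ∧ ∀ x : X',
      IsDomain (X'.presheaf.stalk x) ∧ ∀ d : ℕ, ringKrullDim (X'.presheaf.stalk x) = d →
        ∀ s : Fin d → X'.presheaf.stalk x, (Ideal.span (Set.range s)).radical.IsMaximal →
          RingTheory.Sequence.IsWeaklyRegular (X'.presheaf.stalk x) (List.ofFn s) ∧
          ∀ y : X'.presheaf.stalk x, (∃ e : ℕ, y ^ p ^ e ∈ Ideal.span
            ((fun z : X'.presheaf.stalk x => z ^ p ^ e) ''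
              (Ideal.span (Set.range s) : Set (X'.presheaf.stalk x)))) →
            y ∈ Ideal.span (Set.range s) :=
  Negative.conclusion_of_hasResolution hp f (hasResolution_of_dim_le_one X f hdim)

end Summit.ResolutionOfSingularities.ResolutionOfSingularities.Theorems.FInjectiveMacaulayfication

end
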